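import Summits.Ventures.CertifiedManyBodySolver.Rows.HomTorusModel
import HarnessLib

/-!
# Hubbard tori generated by an additive lattice map (Part II: `H = Γ(h_{Λ'}) + far + wrap`, sharp commutator)

HONEST FRAMING: first certified bounds; not a superconductivity verdict; every number certified or
labelled float. Part II of the kernel transport of NN-Hubbard window certificates to the torus
generated by an additive lattice map `φ : ℤ^d →+ (ℤ/Nℤ)^{d'}` (Part I: `HomTorusModel`). For a window
`Λ' ⊆ ℤ^d` on which `φ` is injective (SHARP hypothesis — nothing is asked of `thicken Λ' 1`) and an
inner region `Λ ⊆ Λ'` all of whose lattice neighbours lie in `Λ'`: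
`homHubbard φ t U = Γ(h_{Λ'}) + far hopping + wrap-around hopping + far repulsion`, the last three even
and supported off the image of `Λ`, hence (graded locality) the EOM transport
`[homHubbard φ t U, Γ(Γ(incl) A)] = Γ([h_{Λ'}, Γ(incl) A])` for every `A ∈ 𝔄_Λ`
(`homHubbard_commutator_fermionEmbed`). Line-by-line the argument of pub-mbboot's
`HubbardTorusCommutatorSharp` / the tree's `HubbardTorusLocalHamiltonianDecomposition` with
`x ↦ x mod L` replaced by `φ` (additivity of `φ` is all that is used).
[cite: BratteliRobinsonII1997, §5.2.2, §6.2.1, Thm. 6.2.4] [cite: FriedliVelenik2017, §3.1]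
-/

noncomputable section

open Matrix Finset
open Literature.MathematicalPhysics.QuantumLattice
open Literature.MathematicalPhysics.QuantumFieldTheory hiding Site
open Literature.MathematicalPhysics.QuantumManyBody.StateRelaxation
open Literature.Probability.LatticeModels
open HubbardWave0
open scoped ComplexOrder ComplexConjugate

namespace Summit.Ventures.CertifiedManyBodySolver.Rows

section LocalHamiltonian

variable {d d' N : ℕ} [NeZero N] (φ : Site d →+ TorusSite d' N) (t U : ℝ)

/-- **The embedded local Hamiltonian, expanded**: `Γ(H_{Λ'})` is the Hubbard Hamiltonian of the
image bonds and sites, `-t Σ_{x∼y ∈ Λ'} Σ_σ c†_{x mod L,σ} c_{y mod L,σ} + U Σ_{x∈Λ'} n n`.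
[cite: arXiv9311033, §2] -/
theorem fermionEmbed_homEmb_localHamiltonian {Λ' : Finset (Site d)}
    (h : Set.InjOn φ ↑Λ') :
    fermionEmbed (homEmb φ h) ((hubbardFermionInteraction d t U).localHamiltonian Λ') =
      -(t : ℂ) • ∑ x ∈ Λ', ∑ y ∈ Λ', (if (zdGraph d).Adj x y then
          ∑ σ : Fin 2, creation (orb (FermionTorus.ofTorusSite (φ x)) σ) *
            annihilation (orb (FermionTorus.ofTorusSite (φ y)) σ) else 0) +
        (U : ℂ) • ∑ x ∈ Λ', numberOp (FermionTorus.ofTorusSite (φ x)) 0 *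
          numberOp (FermionTorus.ofTorusSite (φ x)) 1 := by
  -- sums over `PolySite Λ'` as sums over `Λ'`
  let e : PolySite Λ' ≃ {x // x ∈ Λ'} :=
    ⟨fun a => ⟨ofLex a.1, PolySite.ofLex_mem a⟩, fun x => PolySite.pt x.1 x.2, fun a => PolySite.pt_ofLex a,
      fun x => Subtype.ext rfl⟩
  have hsum : ∀ (f : PolySite Λ' → Matrix (Finset (Orb (FermionTorus d' N))) (Finset (Orb (FermionTorus d' N))) ℂ)
      (g : Site d → Matrix (Finset (Orb (FermionTorus d' N))) (Finset (Orb (FermionTorus d' N))) ℂ),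
      (∀ (x : Site d) (hx : x ∈ Λ'), f (PolySite.pt x hx) = g x) → ∑ a, f a = ∑ x ∈ Λ', g x := by
    intro f g hfg
    rw [← Finset.sum_attach Λ' g, ← Finset.univ_eq_attach]
    exact Fintype.sum_equiv e _ _ fun a => by
      rw [← hfg (e a).1 (e a).2, show PolySite.pt (e a).1 (e a).2 = e.symm (e a) from rfl, Equiv.symm_apply_apply]
  rw [hubbardFermionInteraction_localHamiltonian, hamiltonian, fermionEmbed_add, fermionEmbed_smul, fermionEmbed_smul,
    fermionEmbed_sum, fermionEmbed_sum]
  congr 2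
  · refine hsum _ _ fun x hx => ?_
    rw [fermionEmbed_sum]
    refine hsum _ _ fun y hy => ?_
    by_cases hxy : (zdGraph d).Adj x y
    · rw [if_pos hxy, fermionEmbed_sum]
      refine Finset.sum_congr rfl fun σ _ => ?_
      rw [if_pos ((polyGraph_adj _ _).2 hxy), fermionEmbed_mul, fermionEmbed_creation, fermionEmbed_annihilation,
        homEmb_pt, homEmb_pt]
    · rw [if_neg hxy, Finset.sum_eq_zero fun σ _ => ?_, fermionEmbed_zero]
      exact if_neg fun h' => hxy ((polyGraph_adj _ _).1 h')
  · refine hsum _ _ fun x hx => ?_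
    rw [fermionEmbed_mul, fermionEmbed_numberOp, fermionEmbed_numberOp, homEmb_pt]

/-- **The wrap-around bonds avoid the image of the inner region**: the hopping terms of the torus bonds
`x mod L ∼ y mod L` between image sites of `Λ'` that are NOT images of lattice bonds (`x ≁ y`) lie in the
even CAR subalgebra of the orbitals away from the image of `Λ`, whenever every lattice neighbour of `Λ`
is in `Λ'` and `x ↦ x mod L` is injective on `Λ'`. [cite: BratteliRobinsonII1997, §5.2.2] -/
theorem wrap_hopping_mem_carEvenSubalgebra_hom {Λ Λ' : Finset (Site d)} (hΛ : Λ ⊆ Λ')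
    (hclosed : ∀ x ∈ Λ, ∀ i : Fin d, x + unitVec i ∈ Λ' ∧ x - unitVec i ∈ Λ')
    (hInj : Set.InjOn φ ↑Λ') :
    (∑ x ∈ Λ', ∑ y ∈ Λ',
        (if (homTorusGraph φ).Adj (FermionTorus.ofTorusSite (φ x))
              (FermionTorus.ofTorusSite (φ y)) ∧ ¬(zdGraph d).Adj x y then
          ∑ σ : Fin 2, creation (orb (FermionTorus.ofTorusSite (φ x)) σ) *
            annihilation (orb (FermionTorus.ofTorusSite (φ y)) σ)
        else 0)) ∈
      carEvenSubalgebra (orbs (Λ.image fun x => FermionTorus.ofTorusSite (φ x)))ᶜ := by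
  refine sum_mem fun x hx => sum_mem fun y hy => ?_
  by_cases h : (homTorusGraph φ).Adj (FermionTorus.ofTorusSite (φ x))
      (FermionTorus.ofTorusSite (φ y)) ∧ ¬(zdGraph d).Adj x y
  · rw [if_pos h]
    have hxΛ : FermionTorus.ofTorusSite (φ x) ∉
        Λ.image fun z => FermionTorus.ofTorusSite (φ z) := fun hmem =>
      h.2 (zdAdj_of_homTorusGraph_adj φ hclosed hInj (mem_of_hom_mem_image φ hΛ hInj hx hmem) hy h.1)
    have hyΛ : FermionTorus.ofTorusSite (φ y) ∉
        Λ.image fun z => FermionTorus.ofTorusSite (φ z) := fun hmem =>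
      h.2 (zdAdj_of_homTorusGraph_adj φ hclosed hInj (mem_of_hom_mem_image φ hΛ hInj hy hmem) hx
        h.1.symm).symm
    exact sum_mem fun σ _ => creation_mul_annihilation_mem_carEvenSubalgebra
      (Finset.mem_compl.2 fun h' => hxΛ (orb_mem_orbs.1 h'))
      (Finset.mem_compl.2 fun h' => hyΛ (orb_mem_orbs.1 h'))
  · rw [if_neg h]
    exact zero_mem _

omit [NeZero N] in
/-- The hopping term of a torus bond avoiding the image of `Λ` is even and supported away from it.
[cite: BratteliRobinsonII1997, §5.2.2] -/
theorem sum_ite_homTorusGraph_adj_mem_carEvenSubalgebra {I : Finset (FermionTorus d' N)} {a b : FermionTorus d' N}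
    (h : (homTorusGraph φ).Adj a b → a ∉ I ∧ b ∉ I) :
    (∑ σ : Fin 2, (if (homTorusGraph φ).Adj a b then creation (orb a σ) * annihilation (orb b σ) else 0)) ∈
      carEvenSubalgebra (orbs I)ᶜ := by
  by_cases hadj : (homTorusGraph φ).Adj a b
  · refine sum_mem fun σ _ => ?_
    rw [if_pos hadj]
    exact creation_mul_annihilation_mem_carEvenSubalgebra
      (Finset.mem_compl.2 fun h' => (h hadj).1 (orb_mem_orbs.1 h'))
      (Finset.mem_compl.2 fun h' => (h hadj).2 (orb_mem_orbs.1 h'))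
  · rw [Finset.sum_eq_zero fun σ _ => if_neg hadj]
    exact zero_mem _

/-- **The far hopping terms are even and supported away from the image of `Λ`.**
[cite: BratteliRobinsonII1997, §5.2.2] -/
theorem far_hopping_mem_carEvenSubalgebra_hom {Λ Λ' : Finset (Site d)} (hΛ : Λ ⊆ Λ')
    (hclosed : ∀ x ∈ Λ, ∀ i : Fin d, x + unitVec i ∈ Λ' ∧ x - unitVec i ∈ Λ') :
    (∑ a : FermionTorus d' N, ∑ b : FermionTorus d' N,
        (if ¬(a ∈ Λ'.image (fun x => FermionTorus.ofTorusSite (φ x)) ∧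
            b ∈ Λ'.image (fun x => FermionTorus.ofTorusSite (φ x))) then
          ∑ σ : Fin 2, (if (homTorusGraph φ).Adj a b then creation (orb a σ) * annihilation (orb b σ) else 0)
        else 0)) ∈
      carEvenSubalgebra (orbs (Λ.image fun x => FermionTorus.ofTorusSite (φ x)))ᶜ := by
  refine sum_mem fun a _ => sum_mem fun b _ => ?_
  by_cases hab : ¬(a ∈ Λ'.image (fun x => FermionTorus.ofTorusSite (φ x)) ∧
      b ∈ Λ'.image (fun x => FermionTorus.ofTorusSite (φ x)))
  · rw [if_pos hab]
    refine sum_ite_homTorusGraph_adj_mem_carEvenSubalgebra φ fun hadj => ⟨fun ha => hab ?_, fun hb => hab ?_⟩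
    · exact mem_image_and_mem_image_of_homTorusGraph_adj φ hΛ hclosed hadj ha
    · exact (mem_image_and_mem_image_of_homTorusGraph_adj φ hΛ hclosed hadj.symm hb).symm
  · rw [if_neg hab]
    exact zero_mem _

/-- **The far repulsion terms are even and supported away from the image of `Λ`.**
[cite: BratteliRobinsonII1997, §5.2.2] -/
theorem far_onSite_mem_carEvenSubalgebra_hom {Λ Λ' : Finset (Site d)} (hΛ : Λ ⊆ Λ') :
    (∑ a ∈ (Λ'.image (fun x => FermionTorus.ofTorusSite (φ x)))ᶜ, numberOp a 0 * numberOp a 1) ∈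
      carEvenSubalgebra (orbs (Λ.image fun x => FermionTorus.ofTorusSite (φ x)))ᶜ := by
  refine sum_mem fun a ha => numberOp_mul_numberOp_mem_carEvenSubalgebra fun σ => ?_
  refine Finset.mem_compl.2 fun h => Finset.mem_compl.1 ha ?_
  exact Finset.image_subset_image hΛ (orb_mem_orbs.1 h)

/-- The embedded observables of `Λ` live on the orbitals over the image of `Λ`. [folklore] -/
theorem orbs_map_incl_trans_homEmb_subset {Λ Λ' : Finset (Site d)} (hΛ : Λ ⊆ Λ')
    (h : Set.InjOn φ ↑Λ') :
    orbs ((Finset.univ : Finset (PolySite Λ)).map ((PolySite.incl hΛ).trans (homEmb φ h))) ⊆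
      orbs (Λ.image fun x => FermionTorus.ofTorusSite (φ x)) := by
  intro i hi
  rw [mem_orbs] at hi ⊢
  obtain ⟨p, -, hp⟩ := Finset.mem_map.1 hi
  refine Finset.mem_image.2 ⟨ofLex p.1, PolySite.ofLex_mem p, ?_⟩
  rw [← hp, Function.Embedding.trans_apply, homEmb_apply, PolySite.coe_incl]

/-- **`H_L = Γ(H_{Λ'}) + far terms + wrap-around bonds`**: for `x ↦ x mod L` injective on `Λ'`
(only), the Hubbard Hamiltonian of the torus is the embedded free-boundary Hamiltonian of `Λ'` plus the
hopping terms of the torus bonds not inside the image `I'` of `Λ'`, plus the hopping terms of the torus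
bonds inside `I'` that are not images of lattice bonds (wrap-around bonds; absent when `x ↦ x mod L` is
injective on `thicken Λ' 1`, cf. the tree's `hubbardTorus_eq_fermionEmbed_localHamiltonian_add`), plus
the repulsion at the sites outside `I'`. [cite: BratteliRobinsonII1997, §6.2.1 (H_Λ' = H_Λ + W)] -/
theorem homHubbard_eq_fermionEmbed_localHamiltonian_add_wrap {Λ' : Finset (Site d)}
    (hInj : Set.InjOn φ ↑Λ') :
    homHubbard φ t U =
      fermionEmbed (homEmb φ hInj) ((hubbardFermionInteraction d t U).localHamiltonian Λ') +
        (-(t : ℂ) • ∑ a : FermionTorus d' N, ∑ b : FermionTorus d' N,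
            (if ¬(a ∈ Λ'.image (fun x => FermionTorus.ofTorusSite (φ x)) ∧
                b ∈ Λ'.image (fun x => FermionTorus.ofTorusSite (φ x))) then
              ∑ σ : Fin 2, (if (homTorusGraph φ).Adj a b then creation (orb a σ) * annihilation (orb b σ) else 0)
            else 0) +
          -(t : ℂ) • ∑ x ∈ Λ', ∑ y ∈ Λ',
            (if (homTorusGraph φ).Adj (FermionTorus.ofTorusSite (φ x))
                  (FermionTorus.ofTorusSite (φ y)) ∧ ¬(zdGraph d).Adj x y then
              ∑ σ : Fin 2, creation (orb (FermionTorus.ofTorusSite (φ x)) σ) *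
                annihilation (orb (FermionTorus.ofTorusSite (φ y)) σ)
            else 0) +
          (U : ℂ) • ∑ a ∈ (Λ'.image (fun x => FermionTorus.ofTorusSite (φ x)))ᶜ,
            numberOp a 0 * numberOp a 1) := by
  have hι : Set.InjOn (fun x : Site d => FermionTorus.ofTorusSite (φ x)) ↑Λ' :=
    injOn_ofTorusSite_hom φ hInj
  rw [fermionEmbed_homEmb_localHamiltonian, homHubbard, hamiltonian]
  -- the on-site part
  have hsite : ∑ a : FermionTorus d' N, numberOp a 0 * numberOp a 1 =
      ∑ x ∈ Λ', numberOp (FermionTorus.ofTorusSite (φ x)) 0 *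
          numberOp (FermionTorus.ofTorusSite (φ x)) 1 +
        ∑ a ∈ (Λ'.image (fun x => FermionTorus.ofTorusSite (φ x)))ᶜ, numberOp a 0 * numberOp a 1 := by
    rw [← Finset.sum_add_sum_compl (Λ'.image fun x => FermionTorus.ofTorusSite (φ x)),
      Finset.sum_image hι]
  -- the hopping part: split each term according to whether the bond lies in the image of `Λ'`
  have hsplit : ∀ a b : FermionTorus d' N,
      (∑ σ : Fin 2, (if (homTorusGraph φ).Adj a b then creation (orb a σ) * annihilation (orb b σ) else 0)) =
        (if a ∈ Λ'.image (fun x => FermionTorus.ofTorusSite (φ x)) ∧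
            b ∈ Λ'.image (fun x => FermionTorus.ofTorusSite (φ x)) then
          ∑ σ : Fin 2, (if (homTorusGraph φ).Adj a b then creation (orb a σ) * annihilation (orb b σ) else 0)
          else 0) +
        (if ¬(a ∈ Λ'.image (fun x => FermionTorus.ofTorusSite (φ x)) ∧
            b ∈ Λ'.image (fun x => FermionTorus.ofTorusSite (φ x))) then
          ∑ σ : Fin 2, (if (homTorusGraph φ).Adj a b then creation (orb a σ) * annihilation (orb b σ) else 0)
          else 0) := by
    intro a b
    by_cases hab : a ∈ Λ'.image (fun x => FermionTorus.ofTorusSite (φ x)) ∧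
        b ∈ Λ'.image (fun x => FermionTorus.ofTorusSite (φ x))
    · rw [if_pos hab, if_neg (not_not.2 hab), add_zero]
    · rw [if_neg hab, if_pos hab, zero_add]
  -- a bond term between image sites is the image of a lattice bond term or a wrap-around term
  have hterm : ∀ x ∈ Λ', ∀ y ∈ Λ',
      (∑ σ : Fin 2, (if (homTorusGraph φ).Adj (FermionTorus.ofTorusSite (φ x))
          (FermionTorus.ofTorusSite (φ y)) then
        creation (orb (FermionTorus.ofTorusSite (φ x)) σ) *
          annihilation (orb (FermionTorus.ofTorusSite (φ y)) σ) else 0)) =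
        (if (zdGraph d).Adj x y then
            ∑ σ : Fin 2, creation (orb (FermionTorus.ofTorusSite (φ x)) σ) *
              annihilation (orb (FermionTorus.ofTorusSite (φ y)) σ) else 0) +
          (if (homTorusGraph φ).Adj (FermionTorus.ofTorusSite (φ x))
                (FermionTorus.ofTorusSite (φ y)) ∧ ¬(zdGraph d).Adj x y then
            ∑ σ : Fin 2, creation (orb (FermionTorus.ofTorusSite (φ x)) σ) *
              annihilation (orb (FermionTorus.ofTorusSite (φ y)) σ) else 0) := by
    intro x hx y hy
    by_cases hxy : (zdGraph d).Adj x y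
    · have hadj := homTorusGraph_adj_of_zdAdj φ hInj hx hy hxy
      rw [if_pos hxy, if_neg (fun h => h.2 hxy), add_zero]
      exact Finset.sum_congr rfl fun σ _ => if_pos hadj
    · rw [if_neg hxy, zero_add]
      by_cases hadj : (homTorusGraph φ).Adj (FermionTorus.ofTorusSite (φ x))
          (FermionTorus.ofTorusSite (φ y))
      · rw [if_pos ⟨hadj, hxy⟩]
        exact Finset.sum_congr rfl fun σ _ => if_pos hadj
      · rw [if_neg (fun h => hadj h.1)]
        exact Finset.sum_eq_zero fun σ _ => if_neg hadj
  -- the bonds inside the image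
  have hin : ∑ a : FermionTorus d' N, ∑ b : FermionTorus d' N,
      (if a ∈ Λ'.image (fun x => FermionTorus.ofTorusSite (φ x)) ∧
          b ∈ Λ'.image (fun x => FermionTorus.ofTorusSite (φ x)) then
        ∑ σ : Fin 2, (if (homTorusGraph φ).Adj a b then creation (orb a σ) * annihilation (orb b σ) else 0)
        else 0) =
      ∑ x ∈ Λ', ∑ y ∈ Λ', (if (zdGraph d).Adj x y then
          ∑ σ : Fin 2, creation (orb (FermionTorus.ofTorusSite (φ x)) σ) *
            annihilation (orb (FermionTorus.ofTorusSite (φ y)) σ) else 0) +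
        ∑ x ∈ Λ', ∑ y ∈ Λ',
          (if (homTorusGraph φ).Adj (FermionTorus.ofTorusSite (φ x))
                (FermionTorus.ofTorusSite (φ y)) ∧ ¬(zdGraph d).Adj x y then
            ∑ σ : Fin 2, creation (orb (FermionTorus.ofTorusSite (φ x)) σ) *
              annihilation (orb (FermionTorus.ofTorusSite (φ y)) σ) else 0) := by
    calc ∑ a : FermionTorus d' N, ∑ b : FermionTorus d' N,
          (if a ∈ Λ'.image (fun x => FermionTorus.ofTorusSite (φ x)) ∧
              b ∈ Λ'.image (fun x => FermionTorus.ofTorusSite (φ x)) then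
            ∑ σ : Fin 2, (if (homTorusGraph φ).Adj a b then creation (orb a σ) * annihilation (orb b σ) else 0)
            else 0)
        = ∑ a : FermionTorus d' N, (if a ∈ Λ'.image (fun x => FermionTorus.ofTorusSite (φ x)) then
            ∑ b ∈ Λ'.image (fun x => FermionTorus.ofTorusSite (φ x)),
              ∑ σ : Fin 2, (if (homTorusGraph φ).Adj a b then creation (orb a σ) * annihilation (orb b σ) else 0)
            else 0) := by
          refine Finset.sum_congr rfl fun a _ => ?_
          by_cases ha : a ∈ Λ'.image (fun x => FermionTorus.ofTorusSite (φ x))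
          · simp only [ha, true_and, if_true]
            rw [Finset.sum_ite_mem, Finset.univ_inter]
          · simp only [ha, false_and, if_false, Finset.sum_const_zero]
      _ = ∑ a ∈ Λ'.image (fun x => FermionTorus.ofTorusSite (φ x)),
            ∑ b ∈ Λ'.image (fun x => FermionTorus.ofTorusSite (φ x)),
              ∑ σ : Fin 2, (if (homTorusGraph φ).Adj a b then creation (orb a σ) * annihilation (orb b σ) else 0) := by
          rw [Finset.sum_ite_mem, Finset.univ_inter]
      _ = ∑ x ∈ Λ', ∑ y ∈ Λ', ∑ σ : Fin 2,
            (if (homTorusGraph φ).Adj (FermionTorus.ofTorusSite (φ x))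
                (FermionTorus.ofTorusSite (φ y)) then
              creation (orb (FermionTorus.ofTorusSite (φ x)) σ) *
                annihilation (orb (FermionTorus.ofTorusSite (φ y)) σ) else 0) := by
          rw [Finset.sum_image hι]
          exact Finset.sum_congr rfl fun x _ => Finset.sum_image hι
      _ = _ := by
          rw [← Finset.sum_add_distrib]
          refine Finset.sum_congr rfl fun x hx => ?_
          rw [← Finset.sum_add_distrib]
          exact Finset.sum_congr rfl fun y hy => hterm x hx y hy
  have hhop : ∑ a : FermionTorus d' N, ∑ b : FermionTorus d' N, ∑ σ : Fin 2,
        (if (homTorusGraph φ).Adj a b then creation (orb a σ) * annihilation (orb b σ) else 0) =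
      (∑ x ∈ Λ', ∑ y ∈ Λ', (if (zdGraph d).Adj x y then
          ∑ σ : Fin 2, creation (orb (FermionTorus.ofTorusSite (φ x)) σ) *
            annihilation (orb (FermionTorus.ofTorusSite (φ y)) σ) else 0) +
        ∑ x ∈ Λ', ∑ y ∈ Λ',
          (if (homTorusGraph φ).Adj (FermionTorus.ofTorusSite (φ x))
                (FermionTorus.ofTorusSite (φ y)) ∧ ¬(zdGraph d).Adj x y then
            ∑ σ : Fin 2, creation (orb (FermionTorus.ofTorusSite (φ x)) σ) *
              annihilation (orb (FermionTorus.ofTorusSite (φ y)) σ) else 0)) +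
        ∑ a : FermionTorus d' N, ∑ b : FermionTorus d' N,
            (if ¬(a ∈ Λ'.image (fun x => FermionTorus.ofTorusSite (φ x)) ∧
                b ∈ Λ'.image (fun x => FermionTorus.ofTorusSite (φ x))) then
              ∑ σ : Fin 2, (if (homTorusGraph φ).Adj a b then creation (orb a σ) * annihilation (orb b σ) else 0)
            else 0) := by
    rw [← hin, ← Finset.sum_add_distrib]
    refine Finset.sum_congr rfl fun a _ => ?_
    rw [← Finset.sum_add_distrib]
    exact Finset.sum_congr rfl fun b _ => hsplit a b
  rw [hhop, hsite, smul_add, smul_add, smul_add]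
  abel

/-- **`H_L - Γ(H_{Λ'})` is even and far from `Λ`** under the sharp hypothesis: for `Λ ⊆ Λ'` with all
lattice neighbours of `Λ` in `Λ'` and `x ↦ x mod L` injective on `Λ'`, the difference of the torus
Hamiltonian and the embedded local Hamiltonian of `Λ'` lies in the even CAR subalgebra of the orbitals
away from the image of `Λ` (far terms by the tree lemmas `far_hopping_mem_carEvenSubalgebra`,
`far_onSite_mem_carEvenSubalgebra`; wrap-around bonds by `wrap_hopping_mem_carEvenSubalgebra`).
[cite: BratteliRobinsonII1997, §6.2.1 and §5.2.2] -/
theorem homHubbard_sub_fermionEmbed_localHamiltonian_mem_carEvenSubalgebra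
    {Λ Λ' : Finset (Site d)} (hΛ : Λ ⊆ Λ')
    (hclosed : ∀ x ∈ Λ, ∀ i : Fin d, x + unitVec i ∈ Λ' ∧ x - unitVec i ∈ Λ')
    (hInj : Set.InjOn φ ↑Λ') :
    homHubbard φ t U -
        fermionEmbed (homEmb φ hInj) ((hubbardFermionInteraction d t U).localHamiltonian Λ') ∈
      carEvenSubalgebra (orbs (Λ.image fun x => FermionTorus.ofTorusSite (φ x)))ᶜ := by
  rw [homHubbard_eq_fermionEmbed_localHamiltonian_add_wrap φ t U hInj, add_sub_cancel_left]
  exact add_mem (add_mem (SMulMemClass.smul_mem _ (far_hopping_mem_carEvenSubalgebra_hom φ hΛ hclosed))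
      (SMulMemClass.smul_mem _ (wrap_hopping_mem_carEvenSubalgebra_hom φ hΛ hclosed hInj)))
    (SMulMemClass.smul_mem _ (far_onSite_mem_carEvenSubalgebra_hom φ hΛ))

/-- **Graded locality on the torus** (sharp hypothesis): `H_L - Γ(H_{Λ'})` commutes with every
embedded observable of `Λ`. [cite: BratteliRobinsonII1997, §5.2.2] -/
theorem commute_homHubbard_sub_fermionEmbed_localHamiltonian {Λ Λ' : Finset (Site d)}
    (hΛ : Λ ⊆ Λ') (hclosed : ∀ x ∈ Λ, ∀ i : Fin d, x + unitVec i ∈ Λ' ∧ x - unitVec i ∈ Λ')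
    (hInj : Set.InjOn φ ↑Λ') (A : FermionOp Λ) :
    Commute (homHubbard φ t U -
        fermionEmbed (homEmb φ hInj) ((hubbardFermionInteraction d t U).localHamiltonian Λ'))
      (fermionEmbed (homEmb φ hInj) (fermionEmbed (PolySite.incl hΛ) A)) := by
  rw [fermionEmbed_fermionEmbed]
  refine commute_of_mem_carEvenSubalgebra
    (homHubbard_sub_fermionEmbed_localHamiltonian_mem_carEvenSubalgebra φ t U hΛ hclosed hInj)
    (fermionEmbed_mem_carSubalgebra _ A) ?_
  exact disjoint_compl_left_iff.2 (orbs_map_incl_trans_homEmb_subset φ hΛ _)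

/-- **The commutator with the torus Hamiltonian is the embedded local commutator — sharp torus
hypothesis.** For an observable `A` of `Λ`, embedded into the torus through `Λ' ⊇ Λ` (`Λ'` containing
all lattice neighbours of `Λ`, `x ↦ x mod L` injective on `Λ'` — NOT necessarily on `thicken Λ' 1`),
`[H_L, Γ A] = Γ([H_{Λ'}, A])`; the tree's `hubbardTorus_commutator_fermionEmbed` is the special case of an
injectivity hypothesis on `thicken Λ' 1`. Bratteli–Robinson II Thm. 6.2.4 on the torus.
[cite: BratteliRobinsonII1997, Thm. 6.2.4] -/
theorem homHubbard_commutator_fermionEmbed {Λ Λ' : Finset (Site d)}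
    (hΛ : Λ ⊆ Λ') (hclosed : ∀ x ∈ Λ, ∀ i : Fin d, x + unitVec i ∈ Λ' ∧ x - unitVec i ∈ Λ')
    (hInj : Set.InjOn φ ↑Λ') (A : FermionOp Λ) :
    homHubbard φ t U * fermionEmbed (homEmb φ hInj) (fermionEmbed (PolySite.incl hΛ) A) -
        fermionEmbed (homEmb φ hInj) (fermionEmbed (PolySite.incl hΛ) A) * homHubbard φ t U =
      fermionEmbed (homEmb φ hInj)
        ((hubbardFermionInteraction d t U).localHamiltonian Λ' * fermionEmbed (PolySite.incl hΛ) A -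
          fermionEmbed (PolySite.incl hΛ) A * (hubbardFermionInteraction d t U).localHamiltonian Λ') := by
  have hc := commute_homHubbard_sub_fermionEmbed_localHamiltonian φ t U hΛ hclosed hInj A
  rw [Commute, SemiconjBy, sub_mul, mul_sub, sub_eq_sub_iff_sub_eq_sub] at hc
  rw [fermionEmbed_sub, fermionEmbed_mul, fermionEmbed_mul]
  exact hc

end LocalHamiltonian

end Summit.Ventures.CertifiedManyBodySolver.Rows

end
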